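import Summits.BirchSwinnertonDyer.BirchSwinnertonDyer.Theorems.ByReductionTypeAtTwoKatoFreeSandwich
import Summits.BirchSwinnertonDyer.BirchSwinnertonDyer.Theorems.ByReductionTypeAtTwoOrdMissingLowerBoundAtTwoStubMaxPeriodWitness
import Summits.BirchSwinnertonDyer.BirchSwinnertonDyer.Theorems.ByReductionTypeAtTwoKatoFreeSandwichMeasureDepth
import Summits.BirchSwinnertonDyer.BirchSwinnertonDyer.Theorems.ByReductionTypeAtTwoAnalyticMuEisensteinFlat
import Summits.BirchSwinnertonDyer.BirchSwinnertonDyer.Theorems.ByReductionTypeAtTwoFlatWitnessSquare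
import Summits.BirchSwinnertonDyer.BirchSwinnertonDyer.Theorems.ByReductionTypeAtTwoPeriodDescentGamma1
import HarnessLib

/-!
# Route `ByReductionTypeAtTwo` (K4), crux `OrdMissingLowerBoundAtTwo` (stmt-BirchSwinnertonDyer-19577) — the line
# `kato-free-lower-sandwich-two` ASSEMBLED: the crux from the λ-half (crux 19556) and published inputs ONLY
# (`--supports`, helper; conditional reduction — closes nothing)

Cell `bsd-2adic`, lead `cruxlead-stmt-BirchSwinnertonDyer-19577` (g2).  THEOREMS ONLY — no definition, no named fact, no `sorry`;
BSD is not proved by any of this.  This is skeleton v12 of the line with its three by-name stubs turned into hypotheses: every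
statement the line itself posited is now a kernel theorem — the spine (`KatoFreeSandwich.*`, p652707), the max-period selector
(`stub_maxPeriodWitness`, p653776), μ-transport and the optimal tower (p653951, p655109), S2 (p656427, p658372, p658737), S3 =
(★) + THEOREM B at `p = 2` (p659389, p660532) + the flat witness (W) at every odd level (`FlatWitnessTwo.flatWitnessAtTwo`,
p665962: Dirichlet primes `ℓ ≡ 7 (8)`, `ℓ ≡ √−1 (N)` and two order-4 elements of `Γ₀(N)`), and (β) the period descent of an
Eisenstein functional via the `X₁(N)`-optimal curve (`AnalyticMuTwo.periodDescentOfEisenstein_of_gamma1Optimal`, p667647).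

`ordMissingLowerBoundAtTwo_of_published_of_lambdaHalf`: `OrdMissingLowerBoundAtTwo` (the body of item 19577, Miller's lower
half `ord₂ #Ш_an ≤ ord₂ #Ш[2^∞]` on {non-CM, analytic rank 0, good ordinary at 2}) follows from
* the PUBLISHED inputs `Literature.Uncategorized.OrdPublishedInputsAtTwo` (item 19149: modularity, Gross–Zagier–Kolyvagin, Kato
  17.4, Greenberg 4.1 at 2), Cassels' isogeny invariance `bsdRHS_eq_of_isIsogenous` (from item 19567), Abbes–Ullmo
  `abbesUllmo_not_dvd_maninConstant_of_not_dvd_level`, and the `X₁(N)`-optimal datum `exists_optimal_gamma1ParametrizationData`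
  (Conrad–Edixhoven–Stein 2003 §6.1 / Stevens 1989 §2) — all Literature named facts, BY NAME;
* the λ-HALF `TwoAdicTwistConverse.OrdLambdaHalfAtTwo` = crux stmt-BirchSwinnertonDyer-19556 (open, its own line).
So 19577 is exactly as open as 19556 plus print.  [cite: Kato2004Asterisque, Thm. 17.4] [cite: Stevens1989, §2]
-/

set_option autoImplicit false
set_option linter.dupNamespace false

noncomputable section

open scoped Classical MatrixGroups ModularForm

open CongruenceSubgroup WeierstrassCurve Literature.NumberTheory.EllipticCurves
  Literature.NumberTheory.EllipticCurves.ModularForms Literature.NumberTheory.EllipticCurves.Rank1Residual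
  Literature.NumberTheory.EllipticCurves.Rank1Residual.Typed
  Literature.NumberTheory.EllipticCurves.Greenberg1999
  Summit.BirchSwinnertonDyer.Rank1Residual.X1.MuPart
  Summit.BirchSwinnertonDyer.Rank1Residual
  Summit.BirchSwinnertonDyer.BirchSwinnertonDyer.Theorems.KatoFreeSandwich

namespace Summit.BirchSwinnertonDyer.BirchSwinnertonDyer.Theorems.KatoFreeSandwich

/-- **Crux 19577 from the λ-half 19556 and published inputs only** — line `kato-free-lower-sandwich-two` assembled: the
selector «`W″` has 2-adically maximal real period in its class» (`stub_maxPeriodWitness`), the equivalence with period descent of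
measure depth at the `X₀(N)`-optimal curve (`stubAtMaxPeriod_of_periodDescentOfMeasureDepth`), S2/S3 with the flat witness (W)
at every odd level (`AnalyticMuTwo.periodDescentOfMeasureDepth_of_flatWitness_of_eisensteinDescent`,
`FlatWitnessTwo.flatWitnessAtTwo`) and (β) via the `X₁(N)`-optimal curve
(`AnalyticMuTwo.periodDescentOfEisenstein_of_gamma1Optimal`), fed into the Kato sandwich
`ordMissingLowerBoundAtTwo_of_lambdaHalf_of_selector`.  CONDITIONAL on the named facts in its hypotheses and on crux 19556
(`hΛ`); closes nothing. [cite: Kato2004Asterisque, Thm. 17.4] [cite: Stevens1989, §2] -/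
theorem ordMissingLowerBoundAtTwo_of_published_of_lambdaHalf
    (hPub : Literature.Uncategorized.OrdPublishedInputsAtTwo) (hCassels : bsdRHS_eq_of_isIsogenous)
    (hAU : abbesUllmo_not_dvd_maninConstant_of_not_dvd_level)
    (hex : exists_optimal_gamma1ParametrizationData)
    (hΛ : Summit.BirchSwinnertonDyer.BirchSwinnertonDyer.Theorems.TwoAdicTwistConverse.OrdLambdaHalfAtTwo) :
    Summit.BirchSwinnertonDyer.BirchSwinnertonDyer.Theorems.OrdHalvesAtTwo.OrdMissingLowerBoundAtTwo := by
  have hnf : exists_isNewformOf := exists_isNewformOf_of_nonempty_modularParametrizationData hPub.1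
  exact ordMissingLowerBoundAtTwo_of_lambdaHalf_of_selector
    (fun _ W'' => ∀ (W₃ : WeierstrassCurve ℚ) [W₃.IsElliptic] [W₃.IsGloballyMinimal], IsIsogenous W'' W₃ →
      ∀ q : ℚ, W₃.realPeriodRat = (q : ℝ) * W''.realPeriodRat → padicValRat 2 q ≤ 0)
    hPub hCassels hAU hΛ
    (fun W _ _ _ _ => stub_maxPeriodWitness W)
    (fun W W'' _ _ _ _ =>
      stubAtMaxPeriod_of_periodDescentOfMeasureDepth hnf hAU
        (Summit.BirchSwinnertonDyer.BirchSwinnertonDyer.Theorems.AnalyticMuTwo.periodDescentOfMeasureDepth_of_flatWitness_of_eisensteinDescent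
          Summit.BirchSwinnertonDyer.BirchSwinnertonDyer.Theorems.FlatWitnessTwo.flatWitnessAtTwo
          (Summit.BirchSwinnertonDyer.BirchSwinnertonDyer.Theorems.AnalyticMuTwo.periodDescentOfEisenstein_of_gamma1Optimal
            hex hPub hAU)) W W'')

end Summit.BirchSwinnertonDyer.BirchSwinnertonDyer.Theorems.KatoFreeSandwich

end
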